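import Literature.AlgebraicGeometry.HodgeTheory.AlgebraicClasses
import Literature.AlgebraicGeometry.HodgeTheory.RationalClassesRingChange
import HarnessLib

/-!
# Stub `stub_rationalRelations` (line `middle-involution-purity` of crux
# `EndoscopicMiddleDegree.OrthogonalEnveloped`, stmt-HodgeConjecture-14300): `ℂ`-linear relations
# among rational cohomology classes are spanned by `ℚ`-relations

Registered skeleton: line `middle-involution-purity` of crux `OrthogonalEnveloped`; this is the file
`Theorems/EndoscopicMiddleDegreeOrthogonalEnvelopedRationalRelations.lean` of the summit
(`--supports stmt-HodgeConjecture-14300`).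

WHAT IS PROVED. For a topological space `Y`, a degree `k`, a finite family of RATIONAL classes
`v₁, …, v_N ∈ Hᵏ(Y; ℂ)` (`IsRationalClass`) and complex coefficients `c` with `Σ cᵢ vᵢ = 0`, the
vector `c ∈ ℂ^N` is a `ℂ`-linear combination of RATIONAL relation vectors `q ∈ ℚ^N`, `Σ qᵢ vᵢ = 0`
(`ratRel_span_of_isRationalClass`; the registered stub `stub_rationalRelations` is the
case `Y = X(ℂ)`). Equivalently `ker (Φ ⊗ ℂ) = (ker Φ) ⊗ ℂ` for the `ℚ`-linear `Φ q = Σ qᵢ xᵢ`,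
`vᵢ = ι(xᵢ)`, i.e. the injectivity of `Hᵏ(Y; ℚ) ⊗ ℂ → Hᵏ(Y; ℂ)` (Voisin I, §7.1.1), which the tree
has as `linearIndependent_ringChange_iff` (`HodgeTheory/RationalClassesRingChange`, PROVED).

PROOF. Write `vᵢ = ι(xᵢ)` with `xᵢ ∈ Hᵏ(Y; ℚ)` (`IsRationalClass.exists_ringChange_eq`). Choose a
maximal `ℚ`-independent subfamily `(xᵢ)_{i ∈ I₀}` (`exists_linearIndepOn_extension`): every `xⱼ` is
a `ℚ`-combination `Σ_{i ∈ I₀} aⱼᵢ xᵢ`, so `r⁽ʲ⁾ := eⱼ - aⱼ ∈ ℚ^N` is a rational relation for EVERY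
`j`, and `c - Σⱼ cⱼ r⁽ʲ⁾ = Σⱼ cⱼ aⱼ` is a complex relation supported on `I₀`; since `(ι xᵢ)_{i ∈ I₀}`
stays `ℂ`-independent (`linearIndependent_ringChange_iff`) it vanishes, whence `c = Σⱼ cⱼ r⁽ʲ⁾`.

## References

* C. Voisin, *Hodge Theory and Complex Algebraic Geometry I* (2002), §7.1.1.
* A. Hatcher, *Algebraic Topology* (2002), §3.1 p. 198 (change of coefficients).
-/

noncomputable section

-- The crux-workfile namespace `Summit.<P>.<Sub>.Cruxes.…` repeats `HodgeConjecture` (single-conjunct summit).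
set_option linter.dupNamespace false

namespace Summit.HodgeConjecture.HodgeConjecture.Cruxes.OrthogonalEnveloped.MiddleInvolutionPurity

open scoped BigOperators
open CategoryTheory MonoidalCategory CartesianMonoidalCategory
open Literature.AlgebraicGeometry.Motives (SchemeOver ComplexPoints IsSmoothProjective)
open Literature.AlgebraicGeometry.HodgeTheory
open Literature.AlgebraicTopology.SingularHomology

universe u

/-! ## Helper (worker): rational descent of linear relations, for any space `Y` -/

/-- **`ℂ`-linear relations among rational classes are spanned by `ℚ`-relations** (any topological
space `Y`, any degree `k`, any finite index type). For rational classes `v : ι → Hᵏ(Y; ℂ)` and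
`c : ι → ℂ` with `Σ cᵢ • vᵢ = 0`, the coefficient vector `c` lies in the `ℂ`-span of the vectors
`(qᵢ)ᵢ`, `q : ι → ℚ`, with `Σ qᵢ • vᵢ = 0`. Proof: `vᵢ = ι(xᵢ)`, `xᵢ ∈ Hᵏ(Y; ℚ)`; over a maximal
`ℚ`-independent subfamily `I₀` write `xⱼ = Σ_{i ∈ I₀} aⱼᵢ xᵢ`; the rational relations
`r⁽ʲ⁾ = eⱼ - aⱼ` satisfy `c - Σⱼ cⱼ r⁽ʲ⁾ = Σⱼ cⱼ aⱼ`, a complex relation supported on `I₀`, which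
vanishes because `(ι xᵢ)_{i ∈ I₀}` is `ℂ`-independent (`linearIndependent_ringChange_iff`: the
injectivity of `Hᵏ(Y; ℚ) ⊗ ℂ → Hᵏ(Y; ℂ)`).
[cite: VoisinHodgeI2002, §7.1.1] [cite: HatcherAT2002, §3.1 p. 198] -/
theorem ratRel_span_of_isRationalClass {Y : Type u} [TopologicalSpace Y] {k : ℕ}
    {ι : Type*} [Fintype ι] (v : ι → singularCohomology ℂ ℂ Y k) (hv : ∀ i, IsRationalClass (v i))
    (c : ι → ℂ) (hc : ∑ i, c i • v i = 0) :
    c ∈ Submodule.span ℂ {c' : ι → ℂ |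
      (∃ q : ι → ℚ, c' = fun i ↦ (q i : ℂ)) ∧ ∑ i, c' i • v i = 0} := by
  classical
  -- (1) rational lifts `x i ∈ Hᵏ(Y; ℚ)` of the rational classes `v i`
  choose x hx using fun i ↦ (hv i).exists_ringChange_eq
  -- (2) a maximal `ℚ`-linearly independent subfamily `(x i)_{i ∈ I₀}`
  obtain ⟨I₀, -, -, hspan, hind⟩ :=
    exists_linearIndepOn_extension (linearIndepOn_empty ℚ x) (Set.empty_subset Set.univ)
  -- (3) every `x j` is a `ℚ`-combination of the subfamily, with coefficients `a j` supported on `I₀`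
  have hcoef : ∀ j, ∃ a : ι → ℚ, (∀ i, i ∉ I₀ → a i = 0) ∧ ∑ i, a i • x i = x j := by
    intro j
    obtain ⟨l, hl, hlj⟩ := (Finsupp.mem_span_image_iff_linearCombination ℚ).1
      (hspan ⟨j, Set.mem_univ j, rfl⟩)
    refine ⟨l, fun i hi ↦ (Finsupp.mem_supported' ℚ l).1 hl i hi, ?_⟩
    rw [← hlj, Finsupp.linearCombination_apply, Finsupp.sum_fintype]
    exact fun i ↦ zero_smul ℚ (x i)
  choose a ha0 hax using hcoef
  -- complexified: `v j = Σ_i a j i • v i`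
  have hav : ∀ j, ∑ i, ((a j i : ℚ) : ℂ) • v i = v j := by
    intro j
    have h2 := congrArg (singularCohomology.ringChange (algebraMap ℚ ℂ) Y k) (hax j)
    rw [ringChange_sum_smul] at h2
    simpa only [hx] using h2
  -- (4) the rational relations `r j := e_j - a j`
  set r : ι → ι → ℚ := fun j i ↦ (if i = j then 1 else 0) - a j i with hr
  have hrx : ∀ j, ∑ i, r j i • x i = 0 := by
    intro j
    simp only [hr, sub_smul, Finset.sum_sub_distrib, ite_smul, one_smul, zero_smul,
      Finset.sum_ite_eq', Finset.mem_univ, if_true, hax, sub_self]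
  have hrv : ∀ j, ∑ i, ((r j i : ℚ) : ℂ) • v i = 0 := by
    intro j
    have h2 := congrArg (singularCohomology.ringChange (algebraMap ℚ ℂ) Y k) (hrx j)
    rw [ringChange_sum_smul, map_zero] at h2
    simpa only [hx] using h2
  have hrC : ∀ j i, ((r j i : ℚ) : ℂ) = (if i = j then (1 : ℂ) else 0) - ((a j i : ℚ) : ℂ) := by
    intro j i
    simp only [hr, Rat.cast_sub]
    split_ifs <;> simp
  -- (5) the subfamily stays `ℂ`-independent after `ι`
  have hC : LinearIndependent ℂ (fun i : I₀ ↦ v i) := by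
    have h := (linearIndependent_ringChange_iff (fun i : I₀ ↦ x i)).2 hind
    simpa only [hx] using h
  -- (6) `c = Σ_j c j • r j`: the difference `d = Σ_j c j • a j` is a relation supported on `I₀`
  set d : ι → ℂ := fun i ↦ ∑ j, c j * ((a j i : ℚ) : ℂ) with hd
  have hd0 : ∀ i, i ∉ I₀ → d i = 0 := fun i hi ↦ by
    simp only [hd, ha0 _ i hi, Rat.cast_zero, mul_zero, Finset.sum_const_zero]
  have hdrel : ∑ i, d i • v i = 0 := by
    calc ∑ i, d i • v i = ∑ i, ∑ j, (c j * ((a j i : ℚ) : ℂ)) • v i := by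
            simp only [hd, Finset.sum_smul]
      _ = ∑ j, ∑ i, (c j * ((a j i : ℚ) : ℂ)) • v i := Finset.sum_comm
      _ = ∑ j, c j • v j := by simp only [mul_smul, ← Finset.smul_sum, hav]
      _ = 0 := hc
  have hdI : ∑ i : I₀, d i • v i = 0 := by
    rw [Finset.sum_set_coe (f := fun i ↦ d i • v i), ← hdrel]
    exact Finset.sum_subset (Finset.subset_univ _) fun i _ hi ↦ by
      rw [hd0 i (fun h ↦ hi (Set.mem_toFinset.2 h)), zero_smul]
  have hdz : ∀ i, d i = 0 := fun i ↦ by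
    by_cases hi : i ∈ I₀
    · exact Fintype.linearIndependent_iff.1 hC (fun i : I₀ ↦ d i) hdI ⟨i, hi⟩
    · exact hd0 i hi
  have key : c = ∑ j, c j • (fun i ↦ ((r j i : ℚ) : ℂ)) := by
    funext i
    simp only [Finset.sum_apply, Pi.smul_apply, smul_eq_mul, hrC, mul_sub,
      Finset.sum_sub_distrib, mul_ite, mul_one, mul_zero, Finset.sum_ite_eq, Finset.mem_univ,
      if_true]
    rw [show ∑ j, c j * ((a j i : ℚ) : ℂ) = d i from rfl, hdz i, sub_zero]
  rw [key]
  exact Submodule.sum_mem _ fun j _ ↦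
    Submodule.smul_mem _ _ (Submodule.subset_span ⟨⟨r j, rfl⟩, hrv j⟩)

/-! ## The registered stub -/

/-- **Stub 4a (lead reshape R2) — ℂ-LINEAR RELATIONS AMONG RATIONAL CLASSES ARE SPANNED BY
ℚ-RELATIONS.** For rational classes `v₁, …, v_N ∈ Hᵏ(X(ℂ); ℂ)` and complex coefficients `c` with
`Σ cᵢ vᵢ = 0`, the vector `c ∈ ℂ^N` is a ℂ-combination of RATIONAL relation vectors `q ∈ ℚ^N`,
`Σ qᵢ vᵢ = 0` (`ratRel_span_of_isRationalClass` at `Y = X(ℂ)`: `vᵢ = ι xᵢ` with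
`xᵢ ∈ Hᵏ(X(ℂ); ℚ)`, a maximal ℚ-independent subfamily stays ℂ-independent after `ι` by
`linearIndependent_ringChange_iff`, and the rational relations `eⱼ - Σ_i aⱼᵢ eᵢ` expressing the other
`xⱼ` over it span all complex relations; equivalently `ker (Φ ⊗ ℂ) = (ker Φ) ⊗ ℂ` for
`Φ q = Σ qᵢ xᵢ`, since `Hᵏ(ℚ) ⊗ ℂ → Hᵏ(ℂ)` is injective).
[cite: VoisinHodgeI2002, §7.1.1] [cite: HatcherAT2002, §3.1 p. 198] -/
theorem stub_rationalRelations :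
    ∀ (X : SchemeOver ℂ) (k N : ℕ) (v : Fin N → complexBetti X k), (∀ i, IsRationalClass (v i)) →
      ∀ c : Fin N → ℂ, ∑ i, c i • v i = 0 →
        c ∈ Submodule.span ℂ {c' : Fin N → ℂ |
          (∃ q : Fin N → ℚ, c' = fun i ↦ (q i : ℂ)) ∧ ∑ i, c' i • v i = 0} :=
  fun _X _k _N v hv c hc ↦ ratRel_span_of_isRationalClass v hv c hc

end Summit.HodgeConjecture.HodgeConjecture.Cruxes.OrthogonalEnveloped.MiddleInvolutionPurity

end
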